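import Summits.CriticalPhenomena.SAWScalingLimit.Theorems.HexConjecture.Negative.NonVacuity
import Summits.CriticalPhenomena.SAWScalingLimit.Theorems.ObservableToSLER.Negative.RootPinNecessity
import Summits.CriticalPhenomena.SAWScalingLimit.Theorems.ObservableToSLE.Negative.Identification
import Literature.Probability.RandomPlanarGeometry.ChordalReversibility
import Literature.Probability.Percolation.LoopRotationInvarianceAssembly

/-!
# `HexConjecture` — reversal: the exact lattice identity and the REVERSIBILITY DEBT of the crux

Support file for crux `stmt-CriticalPhenomena-0808` (cdisprove, cycle 2).

§1 (positive, reusable): time reversal of domain self-avoiding walks of an embedded graph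
(`sawReverse`, an involution/`Equiv`), the EXACT identities
`(embWeight … x a b).map sawReverse = embWeight … x b a`,
`(embLaw … x a b).map sawReverse = embLaw … x b a` (the fugacity weight `x^{ℓ(γ)}` is
reversal invariant — LSW 2004 §3.1), and `(sawReverse γ).curve = CurveClass.reverse γ.curve`
(reversing the vertex list reverses the polyline modulo reparametrisation).

§2: an endpoint approximation of `(D; a, b)` is, read backwards, an endpoint approximation of
the swapped Dobrushin domain `D.swap = (D; b, a)` (`isEmbEndpointApprox_swap`).

§3 (the debt): for the critical hexagonal SAW, `∫ f(γ.curve) dP^{(b,a)}_δ = ∫ f(reverse γ.curve)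
dP^{(a,b)}_δ` for EVERY mesh (`integral_curve_hexSAWLaw_swap`); hence two limits in law of the
`(a,b)`- and `(b,a)`-families are time reversals of each other
(`map_reverse_eq_of_tendstoLaw`), and **any proof of `HexConjecture` proves the reversibility of
chordal SLE(8/3)** (Zhan 2008, `κ ∈ (0,4]`; for `κ = 8/3` also LSW 2003 via restriction) in every
Dobrushin domain carrying a hexagonal endpoint approximation:
`isSLELaw_swap_of_hexConjecture : HexConjecture → IsSLELaw (8/3) D μ → IsSLELaw (8/3) D.swap
(μ.map reverse)`, unconditionally on the unit disc (`isSLELaw_swap_unitDisc_of_hexConjecture`),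
and the SLE(8/3) laws of `(D; a, b)` and `(D; b, a)` determine each other
(`sleLaw_swap_eq_map_reverse_of_hexConjecture`). No reversibility theorem for SLE is in the tree
(searched: `ChordalReversibility.lean` only DEFINES `ChordalFamily.IsReversible`); this is a
second existence-type debt of the crux next to `exists_isSLECurve_unitDisc_of_hexConjecture`.
-/

noncomputable section

namespace Summit.CriticalPhenomena.SAWScalingLimit.Cruxes.HexConjecture.Reversal

open MeasureTheory Filter Topology Set
open Literature.Probability.LatticeModels Literature.Probability.RandomPlanarGeometry
open Literature.Probability.RandomPlanarGeometry.SAW Literature.Probability.Process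
open scoped NNReal ENNReal BoundedContinuousFunction

/-! ## §1 Time reversal of domain SAWs of an embedded graph -/

section Generic

variable {V : Type*} {G : SimpleGraph V} {emb : V → ℂ} {Ω : Set ℂ} {δ : ℝ} {a b : V}

/-- Time reversal of a self-avoiding walk of `Ω_δ`: the reversed walk (still self-avoiding). [folklore] -/
def sawReverse (γ : EmbDomainSAW G emb Ω δ a b) : EmbDomainSAW G emb Ω δ b a :=
  ⟨γ.walk.reverse, γ.isPath.reverse⟩

/-- The underlying walk of the reversed SAW. [folklore] -/
@[simp] theorem walk_sawReverse (γ : EmbDomainSAW G emb Ω δ a b) :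
    (sawReverse γ).walk = γ.walk.reverse := rfl

/-- Time reversal is an involution. [folklore] -/
@[simp] theorem sawReverse_sawReverse (γ : EmbDomainSAW G emb Ω δ a b) :
    sawReverse (sawReverse γ) = γ := by
  obtain ⟨w, hw⟩ := γ
  simp only [sawReverse, SimpleGraph.Walk.reverse_reverse]

/-- Time reversal as an equivalence `SAW(a → b) ≃ SAW(b → a)`. [folklore] -/
def sawReverseEquiv : EmbDomainSAW G emb Ω δ a b ≃ EmbDomainSAW G emb Ω δ b a where
  toFun := sawReverse
  invFun := sawReverse
  left_inv := sawReverse_sawReverse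
  right_inv := sawReverse_sawReverse

/-- `sawReverseEquiv` is `sawReverse`. [folklore] -/
@[simp] theorem sawReverseEquiv_apply (γ : EmbDomainSAW G emb Ω δ a b) :
    sawReverseEquiv γ = sawReverse γ := rfl

/-- Time reversal as a measurable equivalence (discrete σ-algebras). [folklore] -/
def sawReverseMeasurableEquiv : EmbDomainSAW G emb Ω δ a b ≃ᵐ EmbDomainSAW G emb Ω δ b a where
  toEquiv := sawReverseEquiv
  measurable_toFun := EmbDomainSAW.measurable_of_top _
  measurable_invFun := EmbDomainSAW.measurable_of_top _

/-- `sawReverseMeasurableEquiv` is `sawReverse`. [folklore] -/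
@[simp] theorem sawReverseMeasurableEquiv_apply (γ : EmbDomainSAW G emb Ω δ a b) :
    sawReverseMeasurableEquiv γ = sawReverse γ := rfl

/-- Reversal preserves the number of steps. [folklore] -/
@[simp] theorem length_sawReverse (γ : EmbDomainSAW G emb Ω δ a b) :
    (sawReverse γ).length = γ.length := by
  simp [EmbDomainSAW.length, sawReverse]

/-- Reversal preserves the number of visited vertices `ℓ(γ)`. [folklore] -/
@[simp] theorem vertexCount_sawReverse (γ : EmbDomainSAW G emb Ω δ a b) :
    (sawReverse γ).vertexCount = γ.vertexCount := by
  simp [EmbDomainSAW.vertexCount]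

/-- **Reversing the walk reverses its curve class**: the polyline through the reversed vertex
list is the time reversal of the polyline, modulo (increasing) reparametrisation
(`reparamDist_polyline_reverse`). [folklore] -/
theorem curve_sawReverse (γ : EmbDomainSAW G emb Ω δ a b) :
    (sawReverse γ).curve = CurveClass.reverse γ.curve := by
  rw [EmbDomainSAW.curve, EmbDomainSAW.curve, CurveClass.reverse_mk, CurveClass.mk_eq_mk]
  simp only [walk_sawReverse, SimpleGraph.Walk.toCurve, SimpleGraph.Walk.support_reverse,
    List.map_reverse]
  exact Literature.Probability.Percolation.reparamDist_polyline_reverse _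

/-- The SAW measure evaluated on a set: the sum of the weights `x^{ℓ(γ)}` over the set. [folklore] -/
theorem embWeight_apply (x : ℝ) (T : Set (EmbDomainSAW G emb Ω δ a b)) :
    embWeight G emb Ω δ x a b T =
      ∑' γ : EmbDomainSAW G emb Ω δ a b, T.indicator (fun γ => ENNReal.ofReal (x ^ γ.vertexCount)) γ := by
  rw [embWeight, Measure.sum_apply _ MeasurableSpace.measurableSet_top]
  refine tsum_congr fun γ => ?_
  rw [Measure.smul_apply, smul_eq_mul, Measure.dirac_apply' _ MeasurableSpace.measurableSet_top]
  by_cases hγ : γ ∈ T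
  · simp [hγ]
  · simp [hγ]

/-- **Exact reversal invariance of the fugacity weight** `γ ↦ x^{ℓ(γ)}`: pushing the SAW measure
of `a → b` forward along time reversal gives the SAW measure of `b → a` (LSW 2004 §3.1: the
weight "`β^{-n}` to each SAW of length `n`" is invariant under `ω ↦ ω^R`). [folklore] -/
theorem map_sawReverse_embWeight (x : ℝ) :
    (embWeight G emb Ω δ x a b).map sawReverse = embWeight G emb Ω δ x b a := by
  ext T -
  rw [Measure.map_apply (EmbDomainSAW.measurable_of_top _) MeasurableSpace.measurableSet_top,
    embWeight_apply, embWeight_apply]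
  rw [← (sawReverseEquiv (G := G) (emb := emb) (Ω := Ω) (δ := δ) (a := a) (b := b)).tsum_eq
    (fun γ' => T.indicator (fun γ' => ENNReal.ofReal (x ^ γ'.vertexCount)) γ')]
  refine tsum_congr fun γ => ?_
  simp only [sawReverseEquiv_apply, Set.indicator, vertexCount_sawReverse]
  rfl

/-- The total weights of `a → b` and `b → a` agree. [folklore] -/
theorem embWeight_univ_swap (x : ℝ) :
    embWeight G emb Ω δ x b a Set.univ = embWeight G emb Ω δ x a b Set.univ := by
  rw [← map_sawReverse_embWeight x,
    Measure.map_apply (EmbDomainSAW.measurable_of_top _) MeasurableSpace.measurableSet_top,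
    Set.preimage_univ]

/-- **Exact reversibility of the law `P_{x,δ}`**: the law of the SAW from `b` to `a` is the
push-forward of the law of the SAW from `a` to `b` along time reversal. [folklore] -/
theorem map_sawReverse_embLaw (x : ℝ) :
    (embLaw G emb Ω δ x a b).map sawReverse = embLaw G emb Ω δ x b a := by
  rw [embLaw, embLaw, Measure.map_smul, map_sawReverse_embWeight, embWeight_univ_swap]

/-- Integration against the `b → a` law is integration of the reversed observable against the
`a → b` law. [folklore] -/
theorem integral_embLaw_swap {F : Type*} [NormedAddCommGroup F] [NormedSpace ℝ F] (x : ℝ)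
    (f : EmbDomainSAW G emb Ω δ b a → F) :
    ∫ γ, f γ ∂(embLaw G emb Ω δ x b a) = ∫ γ, f (sawReverse γ) ∂(embLaw G emb Ω δ x a b) := by
  rw [← map_sawReverse_embLaw x]
  exact integral_map_equiv (sawReverseMeasurableEquiv (G := G) (emb := emb) (Ω := Ω) (δ := δ)
    (a := a) (b := b)) f

end Generic

/-! ## §2 Endpoint approximations read backwards approximate the swapped domain -/

section Swap

variable {V : Type*} {G : SimpleGraph V} {emb : V → ℂ} {D : DobrushinDomain} {a b : ℝ → V}

/-- An endpoint approximation of `(D; a, b)`, read backwards, is an endpoint approximation of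
`D.swap = (D; b, a)` (same carrier, marked points exchanged: `pt_swap_zero/one`). [folklore] -/
theorem isEmbEndpointApprox_swap (h : IsEmbEndpointApprox G emb D a b) :
    IsEmbEndpointApprox G emb D.swap b a where
  reachable := h.reachable.mono fun δ hδ => hδ.symm
  tendsto_fst := by
    rw [MarkedDomain.pt_swap_zero]
    exact h.tendsto_snd
  tendsto_snd := by
    rw [MarkedDomain.pt_swap_one]
    exact h.tendsto_fst

/-- … and conversely (`swap` is an involution on `(carrier, pt 0, pt 1)`). [folklore] -/
theorem isEmbEndpointApprox_of_swap (h : IsEmbEndpointApprox G emb D.swap b a) :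
    IsEmbEndpointApprox G emb D a b where
  reachable := h.reachable.mono fun δ hδ => hδ.symm
  tendsto_fst := by
    rw [← MarkedDomain.pt_swap_one D]
    exact h.tendsto_snd
  tendsto_snd := by
    rw [← MarkedDomain.pt_swap_zero D]
    exact h.tendsto_fst

end Swap

/-! ## §3 The critical hexagonal SAW: law-level reversal and the reversibility debt -/

section Hex

variable {Ω : Set ℂ} {δ : ℝ} {u v : HexVertex}

/-- **Lattice reversibility of the critical hexagonal SAW** (every mesh, every pair of
endpoints, junk cases included): `hexSAWLaw Ω δ v u = (hexSAWLaw Ω δ u v).map sawReverse`. [folklore] -/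
theorem hexSAWLaw_swap (Ω : Set ℂ) (δ : ℝ) (u v : HexVertex) :
    hexSAWLaw Ω δ v u = (hexSAWLaw Ω δ u v).map sawReverse :=
  (map_sawReverse_embLaw _).symm

/-- For every observable `f` of the curve class:
`∫ f(γ.curve) dP^{(v,u)}_δ = ∫ f(reverse γ.curve) dP^{(u,v)}_δ`. [folklore] -/
theorem integral_curve_hexSAWLaw_swap {F : Type*} [NormedAddCommGroup F] [NormedSpace ℝ F]
    (f : CurveClass ℂ → F) :
    ∫ γ, f γ.curve ∂(hexSAWLaw Ω δ v u) = ∫ γ, f (CurveClass.reverse γ.curve) ∂(hexSAWLaw Ω δ u v) := by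
  rw [integral_embLaw_swap]
  simp_rw [curve_sawReverse]

variable {D : DobrushinDomain} {a b : ℝ → HexVertex} {Ω' : Type*} [MeasurableSpace Ω']

/-- **Limits in law of the forward and backward families are time reversals of each other.**
If the `(a_δ → b_δ)` curve classes converge in law to `Z` and the `(b_δ → a_δ)` curve classes to
`Z'` (any limits, on any probability space, a.e.-measurable), then `law(reverse ∘ Z) = law Z'`.
No hypothesis on the endpoints is needed: the lattice identity holds at every mesh. [folklore] -/
theorem map_reverse_eq_of_tendstoLaw {P' : Measure Ω'} [IsProbabilityMeasure P']
    {Z Z' : Ω' → CurveClass ℂ} (hZ : AEMeasurable Z P') (hZ' : AEMeasurable Z' P')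
    (h1 : TendstoLaw (fun δ (γ : HexDomainSAW D.carrier δ (a δ) (b δ)) => γ.curve)
      (fun δ => hexSAWLaw D.carrier δ (a δ) (b δ)) Z P')
    (h2 : TendstoLaw (fun δ (γ : HexDomainSAW D.carrier δ (b δ) (a δ)) => γ.curve)
      (fun δ => hexSAWLaw D.carrier δ (b δ) (a δ)) Z' P') :
    P'.map (CurveClass.reverse ∘ Z) = P'.map Z' := by
  have hrZ : AEMeasurable (CurveClass.reverse ∘ Z) P' :=
    CurveClass.measurable_reverse.comp_aemeasurable hZ
  haveI : IsProbabilityMeasure (P'.map (CurveClass.reverse ∘ Z)) :=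
    Measure.isProbabilityMeasure_map hrZ
  haveI : IsProbabilityMeasure (P'.map Z') := Measure.isProbabilityMeasure_map hZ'
  refine ext_of_forall_integral_eq_of_IsFiniteMeasure fun f => ?_
  rw [integral_map hrZ f.continuous.aestronglyMeasurable,
    integral_map hZ' f.continuous.aestronglyMeasurable]
  -- the reversed test function
  set g : CurveClass ℂ →ᵇ ℝ := f.compContinuous ⟨CurveClass.reverse, CurveClass.continuous_reverse⟩
    with hg
  have h1g := h1 g
  have h2f := h2 f
  have heq : (fun δ => ∫ γ, f ((fun δ (γ : HexDomainSAW D.carrier δ (b δ) (a δ)) => γ.curve) δ γ)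
      ∂(hexSAWLaw D.carrier δ (b δ) (a δ))) =
      fun δ => ∫ γ, g ((fun δ (γ : HexDomainSAW D.carrier δ (a δ) (b δ)) => γ.curve) δ γ)
        ∂(hexSAWLaw D.carrier δ (a δ) (b δ)) := by
    funext δ
    simp only [hg, BoundedContinuousFunction.compContinuous_apply, ContinuousMap.coe_mk]
    exact integral_curve_hexSAWLaw_swap (fun c => f c)
  rw [heq] at h2f
  have := tendsto_nhds_unique h1g h2f
  simpa [hg] using this

open Summit.CriticalPhenomena.SAWScalingLimit.Cruxes.HexConjecture.NonVacuity
  (isEmbEndpointApprox_unitDisc)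

/-- **REVERSIBILITY DEBT, curve form.** `HexConjecture` applied to `(D; a, b)` with an endpoint
approximation `(a_δ, b_δ)` and to `(D; b, a)` with `(b_δ, a_δ)` produces chordal SLE(8/3) curves
`Γ` (from `a` to `b`) and `Γ'` (from `b` to `a`) with `law(reverse ∘ Γ) = law(Γ')`. [folklore] -/
theorem exists_isSLECurve_swap_of_hexConjecture (h : Theses.SAWDefectDecoherence.HexConjecture)
    (hab : IsEmbEndpointApprox hexGraph hexCenter D a b) :
    ∃ Γ Γ', IsSLECurve ((8 : ℝ≥0) / 3) D Γ ∧ IsSLECurve ((8 : ℝ≥0) / 3) D.swap Γ' ∧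
      preWienerMeasure.map (CurveClass.reverse ∘ Γ) = preWienerMeasure.map Γ' := by
  obtain ⟨Γ, hΓ, -, h1⟩ := h D a b hab
  obtain ⟨Γ', hΓ', -, h2⟩ := h D.swap b a (isEmbEndpointApprox_swap hab)
  haveI := isProbabilityMeasure_preWienerMeasure'
  exact ⟨Γ, Γ', hΓ, hΓ', map_reverse_eq_of_tendstoLaw hΓ.aemeasurable hΓ'.aemeasurable h1 h2⟩

/-- **REVERSIBILITY DEBT, law form** (with uniqueness in law of chordal SLE,
`IsSLECurve.map_eq_holds`, PROVED in the tree): under `HexConjecture`, for every Dobrushin domain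
carrying a hexagonal endpoint approximation, the time reversal of ANY chordal SLE(8/3) law of
`(D; a, b)` is a chordal SLE(8/3) law of `(D; b, a)` — Zhan's reversibility theorem (2008,
`κ ≤ 4`) at `κ = 8/3`, which the tree does not have. [folklore] -/
theorem isSLELaw_swap_of_hexConjecture (h : Theses.SAWDefectDecoherence.HexConjecture)
    (hD : ∃ a b : ℝ → HexVertex, IsEmbEndpointApprox hexGraph hexCenter D a b)
    {μ : Measure (CurveClass ℂ)} (hμ : IsSLELaw ((8 : ℝ≥0) / 3) D μ) :
    IsSLELaw ((8 : ℝ≥0) / 3) D.swap (μ.map CurveClass.reverse) := by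
  obtain ⟨a, b, hab⟩ := hD
  obtain ⟨Γ, Γ', hΓ, hΓ', hrev⟩ := exists_isSLECurve_swap_of_hexConjecture h hab
  obtain ⟨Γ₀, hΓ₀, rfl⟩ := hμ
  refine ⟨Γ', hΓ', ?_⟩
  rw [IsSLECurve.map_eq_holds hΓ₀ hΓ, ← hrev,
    AEMeasurable.map_map_of_aemeasurable CurveClass.measurable_reverse.aemeasurable hΓ.aemeasurable]

/-- **REVERSIBILITY DEBT, unconditional instance**: under `HexConjecture`, the time reversal of
any chordal SLE(8/3) law of the unit disc `(𝔻; 1, -1)` is a chordal SLE(8/3) law of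
`(𝔻; -1, 1)` (the disc carries the approximation `isEmbEndpointApprox_unitDisc`). [folklore] -/
theorem isSLELaw_swap_unitDisc_of_hexConjecture (h : Theses.SAWDefectDecoherence.HexConjecture)
    {μ : Measure (CurveClass ℂ)} (hμ : IsSLELaw ((8 : ℝ≥0) / 3) DobrushinDomain.unitDisc μ) :
    IsSLELaw ((8 : ℝ≥0) / 3) DobrushinDomain.unitDisc.swap (μ.map CurveClass.reverse) :=
  isSLELaw_swap_of_hexConjecture h ⟨_, _, isEmbEndpointApprox_unitDisc⟩ hμ

/-- **REVERSIBILITY DEBT, identification form**: under `HexConjecture`, on a Dobrushin domain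
carrying a hexagonal endpoint approximation, EVERY chordal SLE(8/3) law of `(D; b, a)` is the time
reversal of EVERY chordal SLE(8/3) law of `(D; a, b)` (uniqueness in law,
`IsSLECurve.map_eq_holds`) — `P^{SLE(8/3)}_{(D;b,a)} = reverse_* P^{SLE(8/3)}_{(D;a,b)}`, the
clause `ChordalFamily.IsReversible` asks of a curve family. [folklore] -/
theorem sleLaw_swap_eq_map_reverse_of_hexConjecture (h : Theses.SAWDefectDecoherence.HexConjecture)
    (hD : ∃ a b : ℝ → HexVertex, IsEmbEndpointApprox hexGraph hexCenter D a b)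
    {μ μ' : Measure (CurveClass ℂ)} (hμ : IsSLELaw ((8 : ℝ≥0) / 3) D μ)
    (hμ' : IsSLELaw ((8 : ℝ≥0) / 3) D.swap μ') : μ' = μ.map CurveClass.reverse :=
  IsSLELaw.unique IsSLECurve.map_eq_holds hμ' (isSLELaw_swap_of_hexConjecture h hD hμ)

/-- The same with the roles exchanged: every SLE(8/3) law of `(D; a, b)` is the reversal of every
SLE(8/3) law of `(D; b, a)` (reversal is an involution). [folklore] -/
theorem sleLaw_eq_map_reverse_swap_of_hexConjecture (h : Theses.SAWDefectDecoherence.HexConjecture)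
    (hD : ∃ a b : ℝ → HexVertex, IsEmbEndpointApprox hexGraph hexCenter D a b)
    {μ μ' : Measure (CurveClass ℂ)} (hμ : IsSLELaw ((8 : ℝ≥0) / 3) D μ)
    (hμ' : IsSLELaw ((8 : ℝ≥0) / 3) D.swap μ') : μ = μ'.map CurveClass.reverse := by
  rw [sleLaw_swap_eq_map_reverse_of_hexConjecture h hD hμ hμ',
    Measure.map_map CurveClass.measurable_reverse CurveClass.measurable_reverse]
  have : (CurveClass.reverse ∘ CurveClass.reverse : CurveClass ℂ → CurveClass ℂ) = id := by
    funext c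
    simp
  rw [this, Measure.map_id]

end Hex

end Summit.CriticalPhenomena.SAWScalingLimit.Cruxes.HexConjecture.Reversal
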